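import Literature.AlgebraicGeometry.ShimuraVarieties.UnitaryCurveAuxiliarySiegelChart
import Literature.AlgebraicGeometry.ShimuraVarieties.UnitaryCurveSiegelChartMover
import HarnessLib

/-!
# The Siegel chart of the unitary Shimura curve at `J_Φ` WITH ITS RATIONAL MOVERS (E2∕E3 junction, mover edition)

Topic `AlgebraicGeometry/ShimuraVarieties`; namespace `Literature.AlgebraicGeometry.ShimuraVarieties.UnitaryCurve`.  THEOREMS ONLY (no `def`, no named fact,
no instance, no notation, no `sorry`).  Cell `hodgecm-mathlib` (D-0151), FLOOR 0, P6 «MOD programme», door (E) of `stub_RGD`, E-line `F0_P6a_PELWitnessE`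
(GEN heir A-p18 (g31), `AuxChartGS`), organs E2 (A-p17 (g27)) ∕ E3 FILE D (A-p01 (g26) ★ `UnitaryCurveSiegelChartMover`).  `--supports stmt-HodgeConjecture-24832`,
count-neutral; HC_CM is proved only modulo the printed citations until rung 0 closes.

* `exists_siegelChartGS_auxComplexStructureV_mover` — ★ E3 FILE D `exists_siegelChartGS_mover` at the E2 datum `J := auxComplexStructureV F τ Φ`,
  `b := auxToGspFinV F ∘ inl`, `bq := auxToGspRatV F ∘ inl`: the ★ junction `exists_siegelChartGS_auxComplexStructureV` conclusion VERBATIM plus the mover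
  datum `q : U(J⋆)(𝔸_f) → GSp_δ(ℚ)` and the clause (Q) `(q a)_ℝ⁻¹ J_Φ(v) (q a)_ℝ = J(Z a v)`, `(q a)_𝔸 · rep (piece a) K_δ(N) = b(a) K_δ(N)` — the inputs of
  ★ E6-eq layer (b) `exists_siegelLevelGroup_transport_of_mover` (`hQ`, `hq`) and of E1's conjugated lattice reading.  One-term re-export; the E2
  dischargers (`hJ hJneg hJsmul hb hJrat hZ`) are those of the ★ junction file.

## References
* [Deligne1979ShimuraVarieties] P. Deligne, *Variétés de Shimura* (1979), Prop. 2.3.10 (PDF p. 32 of Milne's translation).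
* [Deligne1971TravauxShimura] P. Deligne, *Travaux de Shimura* (1971), Prop. 1.15 p. 132, 4.11–4.12 pp. 148–149, Exemple 4.16 p. 150.
* [Milne2005ShimuraVarieties] J. S. Milne, *Introduction to Shimura varieties* (2005), Lemma 5.13 p. 57, Thm. 5.16, Thm. 6.11 p. 74.
* [MumfordFogartyKirwan1994] D. Mumford, J. Fogarty, F. Kirwan, *Geometric Invariant Theory* (3rd ed. 1994), Appendix to Ch. 7 §A pp. 234–235.
* [RapoportSmithlingZhang2020Diagonal] M. Rapoport, B. Smithling, W. Zhang (2020), Remark 3.2, §3.2 and Prop. 3.7 (proof) pp. 9–14.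
-/

set_option autoImplicit false

noncomputable section

open Function Matrix NumberField IsDedekindDomain CategoryTheory CategoryTheory.Limits AlgebraicGeometry
open scoped Matrix ComplexOrder TensorProduct
open Literature.AlgebraicGeometry.Motives (SchemeOver ComplexPoints AlgPoints specOver CMType)
open Literature.AlgebraicGeometry.AbelianSchemes (PolarizedAbelianSchemeWithLevel)
open Literature.NumberTheory.Automorphic (siegelUpperHalfSpace)
open Literature.NumberTheory.Automorphic.UnitaryGroup
open Literature.AlgebraicGeometry.ModuliOfAbelianVarieties
open Literature.AlgebraicGeometry.ModuliOfAbelianVarieties.SiegelModuli (C0 jOfSiegel jOfSiegel_mem_C0)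

namespace Literature.AlgebraicGeometry.ShimuraVarieties

open UnitaryCanonicalModel
open Literature.AlgebraicGeometry.ShimuraVarieties.UnitaryCanonicalModel.Aux (IsExtAdapted)
open Literature.AlgebraicGeometry.ShimuraVarieties.UnitaryCurve.AuxV

namespace UnitaryCurve

variable {L : Type} [Field L] [NumberField L] [IsCMField L] {Jstar : Matrix (Fin 2) (Fin 2) L} {τ : L →+* ℂ}
variable {g : ℕ} {δ : Fin g → ℕ} {N : ℕ}

/-- **THE SIEGEL CHART OF THE UNITARY SHIMURA CURVE AT DELIGNE'S `J_Φ`, WITH MOVERS** (★ E3 FILE D `exists_siegelChartGS_mover` at the E2 datum): the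
★ junction `exists_siegelChartGS_auxComplexStructureV` (pieces, uniformisations, point map `f`, `piece`, PERIOD FUNCTIONS `Z a`, principal representatives,
`pts`, `f_mk`, shadow, admissibility, classification) VERBATIM, plus the rational MOVERS `q a ∈ GSp_δ(ℚ)` with (Q): `(q a)_ℝ⁻¹ J_Φ(v) (q a)_ℝ = J(Z a v)` on the
cone and `(q a)_𝔸 · rep (piece a) K_δ(N) = b(a) K_δ(N)`.  Inputs by name: ★ A3 (`hJ`, `hJneg` via the ★ junction §1), ★ A2 `auxComplexStructureV_smul`,
★ `hb_auxToGspFinV_inl`, ★ A4 `auxComplexStructureV_hJrat`, ★ C `periodChartV`.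
[cite: Deligne1979ShimuraVarieties, Prop. 2.3.10 (PDF p. 32)] [cite: Deligne1971TravauxShimura, Prop. 1.15 p. 132, Exemple 4.16 p. 150]
[cite: Milne2005ShimuraVarieties, Lemma 5.13 p. 57, Thm. 5.16, Thm. 6.11 p. 74] [cite: MumfordFogartyKirwan1994, Appendix to Ch. 7 §A pp. 234–235]
[cite: RapoportSmithlingZhang2020Diagonal, Remark 3.2 (ii)(iii) pp. 9–10 and Prop. 3.7 pp. 13–14] -/
theorem exists_siegelChartGS_auxComplexStructureV_mover (hU : siegelModuli_complexUniformisation) (hg : 0 < g) (hδ : IsPolarizationType δ)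
    (hN : 3 ≤ N) (𝓜 : SiegelFineModuliScheme g N δ)
    (Φ : CMType L) (hΦ : τ ∈ Φ.1) {ξ : L} (hξ : ∀ ρ : Φ.1, (ρ.1 ξ).im < 0) (F : SymplecticFrameV L (RingHom.id L) Jstar ξ g δ)
    (hJ : (Jstar.map (IsCMField.complexConj L))ᵀ = Jstar)
    (T Ti : Matrix (Fin 2) (Fin 2) ℂ) (hT : Tᴴ * Jstar.map τ * T = signatureMatrix 1) (hTi : T * Ti = 1)
    (hpos : ∀ σ : L →+* ℂ, InfinitePlace.mk σ ≠ InfinitePlace.mk τ → (Jstar.map σ).PosDef)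
    (K : Subgroup ↥(finAdelic (↥(maximalRealSubfield L)) L (IsCMField.complexConj L) 2 Jstar))
    (hle : K ≤ (principalLevelSubgroup δ N).comap ((auxToGspFinV F).comp (MonoidHom.inl _ _))) :
    haveI : IsLocallyNoetherian (specOver ℚ ℂ).left := inferInstanceAs (IsLocallyNoetherian (Spec (CommRingCat.of ℂ)))
    ∃ (Sc : (ZMod N)ˣ → SchemeOver ℂ) (ιc : ∀ c, Sc c ⟶ (Motives.baseChange ℚ ℂ).obj 𝓜.M)
      (unif : ∀ _c : (ZMod N)ˣ, Matrix (Fin g) (Fin g) ℂ → ComplexPoints (Sc _c))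
      (f : ShimuraSetGS L Jstar τ K → ComplexPoints 𝓜.M)
      (piece : ↥(finAdelic (↥(maximalRealSubfield L)) L (IsCMField.complexConj L) 2 Jstar) → (ZMod N)ˣ)
      (Z : ↥(finAdelic (↥(maximalRealSubfield L)) L (IsCMField.complexConj L) 2 Jstar) → (Fin 2 → ℂ) → Matrix (Fin g) (Fin g) ℂ)
      (u : (ZMod N)ˣ → finAdeleQˣ) (rep : (ZMod N)ˣ → ↥(gspFinAdelic δ))
      (pts : ComplexPoints ((Motives.baseChange ℚ ℂ).obj 𝓜.M) ≃ SiegelShimuraSet δ (principalLevelSubgroup δ N))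
      (q : ↥(finAdelic (↥(maximalRealSubfield L)) L (IsCMField.complexConj L) 2 Jstar) → ↥(gspRational δ)),
    -- (U1) component cofan of irreducible pieces
      Nonempty (IsColimit (Cofan.mk ((Motives.baseChange ℚ ℂ).obj 𝓜.M) ιc)) ∧
      (∀ c, IrreducibleSpace (Sc c).left) ∧
    -- (U2+) analytic clauses per piece
      (∀ c, ContinuousOn (unif c) (siegelUpperHalfSpace g)) ∧
      (∀ c, IsOpenMap ((siegelUpperHalfSpace g).restrict (unif c))) ∧
      (∀ c, Set.SurjOn (unif c) (siegelUpperHalfSpace g) Set.univ) ∧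
      (∀ c, ∀ W ∈ siegelUpperHalfSpace g, ∀ W' ∈ siegelUpperHalfSpace g,
        unif c W = unif c W' ↔ ∃ M ∈ siegelLevelGroup δ N, ∃ C : (Fin g → ℂ) ≃ₗ[ℂ] (Fin g → ℂ),
          ∀ x : Fin g ⊕ Fin g → ℝ, C (siegelPeriodMap δ W x) = siegelPeriodMap δ W' (intAct M x)) ∧
      (∀ (c : (ZMod N)ˣ) (U : (Sc c).left.affineOpens) (s : (Sc c).left.presheaf.obj (Opposite.op (↑U : (Sc c).left.Opens))),
        DifferentiableOn ℂ (fun W ↦ AlgPoints.evalOrZero (↑U : (Sc c).left.Opens) s (unif c W))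
          (siegelUpperHalfSpace g ∩ unif c ⁻¹' {P | P.pt ∈ (↑U : (Sc c).left.Opens)})) ∧
    -- principal representatives (the five (U3) premisses)
      (∀ c, (∀ w, Valued.v ((u c : finAdeleQ) w) = 1) ∧ (u c : finAdeleQ) - ((c : ZMod N).val : ℕ) ∈ levelIdeal N ∧
        rep c ∈ principalLevelSubgroup δ 1 ∧
          IsMultiplier (typeFormOver δ finAdeleQ) (rep c : GL (Fin g ⊕ Fin g) finAdeleQ) (u c) ∧
            ((rep c : GL (Fin g ⊕ Fin g) finAdeleQ) : Matrix (Fin g ⊕ Fin g) (Fin g ⊕ Fin g) finAdeleQ) =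
              Matrix.fromBlocks 1 0 0 ((u c : finAdeleQ) • (1 : Matrix (Fin g) (Fin g) finAdeleQ))) ∧
    -- (P) the point map: `Z_hol`, `Z_mem`, `f_mk`, the Shimura-set shadow
      (∀ a (i j : Fin g), DifferentiableOn ℂ (fun v => Z a v i j) (negCone (Jstar.map τ))) ∧
      (∀ a (v : Fin 2 → ℂ), v ∈ negCone (Jstar.map τ) → Z a v ∈ siegelUpperHalfSpace g) ∧
      (∀ (v : Fin 2 → ℂ) (hv : v ∈ negCone (Jstar.map τ)) a,
        f (ShimuraSetGS.mk L Jstar τ K v hv a) =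
          (AlgPoints.baseChangeEquiv (algebraMap ℚ ℂ) 𝓜.M).symm (AlgPoints.map (ιc (piece a)) (unif (piece a) (Z a v)))) ∧
      (∀ (v : Fin 2 → ℂ) (hv : v ∈ negCone (Jstar.map τ)) a,
        pts (AlgPoints.baseChangeEquiv (algebraMap ℚ ℂ) 𝓜.M (f (ShimuraSetGS.mk L Jstar τ K v hv a))) =
          SiegelShimuraSet.mk δ (principalLevelSubgroup δ N) ⟨auxComplexStructureV F τ Φ v, auxComplexStructureV_mem_C0pm_of_frame F Φ hΦ hξ hJ T Ti hT hTi hpos v hv⟩ (((auxToGspFinV F).comp (MonoidHom.inl _ _)) a)) ∧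
      (∀ (v : Fin 2 → ℂ) (hv : v ∈ negCone (Jstar.map τ)) a, ∃ hZv : Z a v ∈ siegelUpperHalfSpace g,
        SiegelShimuraSet.mk δ (principalLevelSubgroup δ N) ⟨auxComplexStructureV F τ Φ v, auxComplexStructureV_mem_C0pm_of_frame F Φ hΦ hξ hJ T Ti hT hTi hpos v hv⟩ (((auxToGspFinV F).comp (MonoidHom.inl _ _)) a) =
          SiegelShimuraSet.mk δ (principalLevelSubgroup δ N)
            ⟨jOfSiegel δ (Z a v), C0_subset_C0pm δ (jOfSiegel_mem_C0 hδ.1 hZv)⟩ (rep (piece a))) ∧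
      (∀ (c : (ZMod N)ˣ) (W : Matrix (Fin g) (Fin g) ℂ) (hW : W ∈ siegelUpperHalfSpace g),
        pts (AlgPoints.map (ιc c) (unif c W)) =
          SiegelShimuraSet.mk δ (principalLevelSubgroup δ N) ⟨jOfSiegel δ W, C0_subset_C0pm δ (jOfSiegel_mem_C0 hδ.1 hW)⟩ (rep c)) ∧
    -- (A) admissibility of the universal triple at the image point ((U3∃)) and classification ((U3-D3))
      (∀ (v : Fin 2 → ℂ) (hv : v ∈ negCone (Jstar.map τ)) a, ∃ hZv : Z a v ∈ siegelUpperHalfSpace g,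
        (∃ (P' : PolarizedAbelianSchemeWithLevel g N δ (specOver ℚ ℂ).left)
            (G : P'.A.X.left ⟶ 𝓜.univ.A.X.left) (Ĝ : P'.D.hat.X.left ⟶ 𝓜.univ.D.hat.X.left),
            P'.IsBaseChangeVia 𝓜.univ (f (ShimuraSetGS.mk L Jstar τ K v hv a)).left G Ĝ ∧
              IsAdmissibleAt hδ (rep (piece a)) (Z a v) hZv P') ∧
        ∀ P' : PolarizedAbelianSchemeWithLevel g N δ (specOver ℚ ℂ).left, IsAdmissibleAt hδ (rep (piece a)) (Z a v) hZv P' →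
          f (ShimuraSetGS.mk L Jstar τ K v hv a) = 𝓜.classifyingMap (specOver ℚ ℂ) P') ∧
    -- (Q) THE MOVERS: `Z a` is E2's period function in the frame `(q a)_ℝ⁻¹`, `q a` tied to `a` adelically
      (∀ (v : Fin 2 → ℂ), v ∈ negCone (Jstar.map τ) → ∀ a,
        conjJ (((gspRationalToReal δ (q a))⁻¹ : ↥(gspReal δ)) : GL (Fin g ⊕ Fin g) ℝ) (auxComplexStructureV F τ Φ v) = jOfSiegel δ (Z a v) ∧
          gspRationalToFinAdelic δ (q a) • ((rep (piece a) : gspFinAdelic δ) : gspFinAdelic δ ⧸ principalLevelSubgroup δ N) =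
            ((((auxToGspFinV F).comp (MonoidHom.inl _ _)) a : gspFinAdelic δ) : gspFinAdelic δ ⧸ principalLevelSubgroup δ N)) :=
  exists_siegelChartGS_mover (auxComplexStructureV F τ Φ)
    (auxComplexStructureV_mem_C0pm_of_frame F Φ hΦ hξ hJ T Ti hT hTi hpos)
    ((auxToGspFinV F).comp (MonoidHom.inl _ _)) ((auxToGspRatV F).comp (MonoidHom.inl _ _)) hU hg hδ hN 𝓜
    (neg_auxComplexStructureV_mem_C0_of_frame F Φ hΦ hξ hJ T Ti hT hTi hpos)
    (fun _ hc v _ => auxComplexStructureV_smul F τ Φ v hc) (hb_auxToGspFinV_inl F)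
    (auxComplexStructureV_hJrat F τ Φ (negCone (Jstar.map τ))) K hle
    (fun γ _ hC => periodChartV L F Φ τ hδ.1 γ hC)

end UnitaryCurve

end Literature.AlgebraicGeometry.ShimuraVarieties

end
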